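import Summits.ABC.ABC.Theorems.IsogenyGlueCongruencePolyDegreeOfBoundedPrimesPolyDegreeOfDepthOfCount

/-!
# Stub `stub_polyDegree_of_depthExists_of_count` (GLUE v2), line `Sketch`, crux stmt-ABC-2046

What is proved. The bookkeeping composition `DEPTH∃ → COUNT → P` of skeleton v2 of crux B
(`PolyDegreeOfBoundedPrimes`, route IsogenyGlueCongruence). Here DEPTH∃ = "for every semistable
globally minimal `W` (level `N = W.conductorNorm ℤ`) there is a modular parametrisation datum `D₁`
all of whose prime powers satisfy `ℓ^{v_ℓ(deg D₁)} ≤ C₁ N^{κ₁}`", COUNT = "below every datum `D₀`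
there is a datum `D`, `deg D ∣ deg D₀`, with
`Σ_{ℓ ∣ deg D} min(v_ℓ(deg D) log ℓ, log N) ≤ κ₂ log N + C₂`", and P = the polynomial modular-degree
statement `∃ κ C, ∀ W …, ∃ D, deg D ≤ C N^κ` (the consequent of the crux).

Proof. Normalise `K₁ = max κ₁ 0`, `B₁ = max C₁ 2`, `M = 1 + K₁ + log B₁ / log 2`, and take
`κ = M κ₂`, `C = exp((B₁ + 1) log B₁ + M C₂)`. For a curve `W` take `D₁` from DEPTH∃ and `D` below
`D₁` from COUNT. As `deg D ∣ deg D₁`, every prime power of `d = deg D` is at most the corresponding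
prime power of `deg D₁`, hence `≤ C₁ N^{κ₁} ≤ B₁ N^{K₁}` (`N ≥ 1`). The landed arithmetic core
`PolyDegreeOfDepthOfCount.le_exp_mul_rpow` (GLUE v1) then gives `d ≤ C · N^κ`. Witness: `D`.

Sources: folklore bookkeeping on top of the landed GLUE v1 module
`IsogenyGlueCongruencePolyDegreeOfBoundedPrimesPolyDegreeOfDepthOfCount` (Mathlib only; no
literature fact is used). This file supports `stmt-ABC-2046`: its only theorem
`stub_polyDegree_of_depthExists_of_count` is, verbatim, the registered GLUE v2 stub of skeleton v2
of the line `Sketch`.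
-/

-- single-conjunct summit ABC: the duplicate ABC.ABC is mandated (CONVENTIONS §2)
set_option linter.dupNamespace false

namespace Summit.ABC.ABC.Theorems

open scoped BigOperators

/-- **GLUE v2 stub of the line `Sketch` (crux stmt-ABC-2046), registered form:**
`DEPTH∃ → COUNT → P`. DEPTH∃ supplies a datum `D₁` at level `N` with all prime powers of `deg D₁`
at most `C₁ N^{κ₁}`; COUNT below `D₁` gives `D` with `deg D ∣ deg D₁` (so the same prime-power
bound, `PolyDegreeOfDepthOfCount.pow_factorization_le_of_dvd`) and truncated log-mass
`≤ κ₂ log N + C₂`; the core estimate `PolyDegreeOfDepthOfCount.le_exp_mul_rpow` then bounds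
`deg D ≤ C · N^κ` with `κ = M κ₂`, `C = exp((B₁ + 1) log B₁ + M C₂)`, `B₁ = max C₁ 2`,
`M = 1 + max κ₁ 0 + log B₁ / log 2`. [folklore] -/
theorem stub_polyDegree_of_depthExists_of_count : (∃ κ C : ℝ, ∀ (W : WeierstrassCurve ℚ) [W.IsElliptic] [W.IsGloballyMinimal] [NeZero (W.conductorNorm ℤ)], W.IsSemistable ℤ → ∃ D : Literature.NumberTheory.EllipticCurves.ModularForms.ModularParametrizationData W (W.conductorNorm ℤ), ∀ ℓ : ℕ, ℓ.Prime → ((ℓ ^ (D.modularDegree).factorization ℓ : ℕ) : ℝ) ≤ C * (W.conductorNorm ℤ : ℝ) ^ κ) → (∃ κ C : ℝ, ∀ (W : WeierstrassCurve ℚ) [W.IsElliptic] [W.IsGloballyMinimal] [NeZero (W.conductorNorm ℤ)], W.IsSemistable ℤ → ∀ D₀ : Literature.NumberTheory.EllipticCurves.ModularForms.ModularParametrizationData W (W.conductorNorm ℤ), ∃ D : Literature.NumberTheory.EllipticCurves.ModularForms.ModularParametrizationData W (W.conductorNorm ℤ), D.modularDegree ∣ D₀.modularDegree ∧ (∑ ℓ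 ∈ (D.modularDegree).primeFactors, min (((D.modularDegree).factorization ℓ : ℝ) * Real.log ℓ) (Real.log (W.conductorNorm ℤ : ℝ))) ≤ κ * Real.log (W.conductorNorm ℤ : ℝ) + C) → ∃ κ C : ℝ, ∀ (W : WeierstrassCurve ℚ) [W.IsElliptic] [W.IsGloballyMinimal] [NeZero (W.conductorNorm ℤ)], W.IsSemistable ℤ → ∃ D : Literature.NumberTheory.EllipticCurves.ModularForms.ModularParametrizationData W (W.conductorNorm ℤ), (D.modularDegree : ℝ) ≤ C * (W.conductorNorm ℤ : ℝ) ^ κ := by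
  intro hD hC
  obtain ⟨κ₁, C₁, hD⟩ := hD
  obtain ⟨κ₂, C₂, hC⟩ := hC
  -- normalised constants `K₁ ≥ max κ₁ 0`, `B₁ ≥ max C₁ 2`, `M = 1 + K₁ + log B₁ / log 2`
  obtain ⟨K₁, hK₁, hκK₁⟩ : ∃ K : ℝ, 0 ≤ K ∧ κ₁ ≤ K := ⟨max κ₁ 0, le_max_right _ _, le_max_left _ _⟩
  obtain ⟨B₁, hB₁, hCB₁⟩ : ∃ B : ℝ, 2 ≤ B ∧ C₁ ≤ B := ⟨max C₁ 2, le_max_right _ _, le_max_left _ _⟩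
  obtain ⟨M, hM⟩ : ∃ M : ℝ, 1 + K₁ + Real.log B₁ / Real.log 2 ≤ M := ⟨_, le_rfl⟩
  refine ⟨M * κ₂, Real.exp ((B₁ + 1) * Real.log B₁ + M * C₂), ?_⟩
  intro W _ _ _ hW
  -- the chain of data: DEPTH∃, then COUNT below it
  obtain ⟨D₁, hD₁⟩ := hD W hW
  obtain ⟨D, hdvd, hD₂⟩ := hC W hW D₁
  have hN0 : W.conductorNorm ℤ ≠ 0 := NeZero.ne _
  have hN1 : (1 : ℝ) ≤ (W.conductorNorm ℤ : ℝ) := by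
    exact_mod_cast Nat.one_le_iff_ne_zero.mpr hN0
  refine ⟨D, PolyDegreeOfDepthOfCount.le_exp_mul_rpow hK₁ hB₁ hM hN0 D.deg_pos.ne' ?_ hD₂⟩
  -- DEPTH for `deg D` from DEPTH for `deg D₁` along `deg D ∣ deg D₁`, constants normalised
  intro ℓ hℓ
  have hℓp : ℓ.Prime := Nat.prime_of_mem_primeFactors hℓ
  calc ((ℓ ^ (D.modularDegree).factorization ℓ : ℕ) : ℝ)
      ≤ ((ℓ ^ (D₁.modularDegree).factorization ℓ : ℕ) : ℝ) := by
        exact_mod_cast PolyDegreeOfDepthOfCount.pow_factorization_le_of_dvd D.deg_pos.ne'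
          D₁.deg_pos.ne' hdvd hℓp.pos
    _ ≤ C₁ * (W.conductorNorm ℤ : ℝ) ^ κ₁ := hD₁ ℓ hℓp
    _ ≤ B₁ * (W.conductorNorm ℤ : ℝ) ^ K₁ :=
        PolyDegreeOfDepthOfCount.mul_rpow_mono hN1 hCB₁ hκK₁ (by linarith)

end Summit.ABC.ABC.Theorems
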